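import Summits.Parity.GeneralizedHardyLittlewood.Theses.LiouvilleMAD
import Literature.NumberTheory.Sieve.ParityBarrier

/-!
# `DilatedChowlaToTypeII` (route `LiouvilleMAD`, item stmt-Parity-13323)

`DilatedChowla → TypeIILiouville`: the power-saving two-point Chowla bound for dilated pairs,
`|∑_{m ∈ (M,2M]} λ(mn+c) λ(mn'+c)| ≤ C · M^{1-κ}` uniformly in `1 ≤ n ≠ n' ≤ 2M`, gives the Type II
bound for `λ(mn+c)` on the balanced range `1 ≤ N ≤ M` with `η = κ/2` and constant
`max 1 √(max C 0)`.

Proof (Cauchy–Schwarz over the long variable `m`; Harman 2007 ch. 3, Iwaniec–Kowalski §13):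
with `g(m) = ∑_n β_n λ(mn+c)`,
`|B|² ≤ ‖α‖² ∑_m g(m)² = ‖α‖² ∑_{n,n'} β_n β_{n'} ∑_m λ(mn+c) λ(mn'+c)`;
the diagonal `n = n'` contributes at most `M ‖β‖²` (`|λ| ≤ 1`, `M` terms), the off-diagonal at most
`C₀ M^{1-κ} (∑|β_n|)² ≤ C₀ M^{1-κ} N ‖β‖²` (`C₀ = max C 0`; `n, n' ∈ (N,2N]` so
`1 ≤ n ≠ n' ≤ 2N ≤ 2M` is inside `DilatedChowla`'s range). Hence
`|B| ≤ ‖α‖ ‖β‖ √(M + C₀ N M^{1-κ}) ≤ ‖α‖ ‖β‖ (√M + √C₀ √N M^{(1-κ)/2})`, and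
`√(MN) (N^{-1/2} + M^{-κ/2}) = √M + √N M^{(1-κ)/2}`.

The analytic core is `abs_bilinear_le_of_correlations`, stated for an arbitrary kernel
`L : ℕ → ℕ → ℝ` with `|L| ≤ 1` and an off-diagonal correlation bound; the closing theorem
`dilatedChowlaToTypeII_proof` specialises it to `L m n = λ((mn+c)⁺)`.
-/

namespace Summit.Parity.GeneralizedHardyLittlewood.Theorems

open Finset
open Summit.Parity.GeneralizedHardyLittlewood.Theses.LiouvilleMAD

/-- `√(x + y) ≤ √x + √y` for `0 ≤ x, y` (subadditivity of the square root). -/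
private theorem sqrt_add_le_sqrt_add_sqrt {x y : ℝ} (hx : 0 ≤ x) (hy : 0 ≤ y) :
    √(x + y) ≤ √x + √y := by
  rw [Real.sqrt_le_left (by positivity)]
  nlinarith [Real.sq_sqrt hx, Real.sq_sqrt hy, Real.sqrt_nonneg x, Real.sqrt_nonneg y,
    mul_nonneg (Real.sqrt_nonneg x) (Real.sqrt_nonneg y)]

/-- Cauchy–Schwarz over the long variable and expansion of the square:
`(∑_m ∑_n α_m β_n L(m,n))² ≤ (∑_m α_m²) · ∑_{n,n'} β_n β_{n'} ∑_m L(m,n) L(m,n')`. -/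
theorem bilinear_sq_le_mul_correlation_form (s t : Finset ℕ) (α β : ℕ → ℝ) (L : ℕ → ℕ → ℝ) :
    (∑ m ∈ s, ∑ n ∈ t, α m * β n * L m n) ^ 2 ≤
      (∑ m ∈ s, α m ^ 2) * ∑ n ∈ t, ∑ n' ∈ t, β n * β n' * ∑ m ∈ s, L m n * L m n' := by
  calc (∑ m ∈ s, ∑ n ∈ t, α m * β n * L m n) ^ 2
      = (∑ m ∈ s, α m * ∑ n ∈ t, β n * L m n) ^ 2 := by
        congr 1
        refine sum_congr rfl fun m _ => ?_
        rw [mul_sum]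
        exact sum_congr rfl fun n _ => by ring
    _ ≤ (∑ m ∈ s, α m ^ 2) * ∑ m ∈ s, (∑ n ∈ t, β n * L m n) ^ 2 :=
        sum_mul_sq_le_sq_mul_sq s α fun m => ∑ n ∈ t, β n * L m n
    _ = (∑ m ∈ s, α m ^ 2) * ∑ n ∈ t, ∑ n' ∈ t, β n * β n' * ∑ m ∈ s, L m n * L m n' := by
        congr 1
        calc ∑ m ∈ s, (∑ n ∈ t, β n * L m n) ^ 2
            = ∑ m ∈ s, ∑ n ∈ t, ∑ n' ∈ t, β n * β n' * (L m n * L m n') := by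
              refine sum_congr rfl fun m _ => ?_
              rw [sq, sum_mul_sum]
              exact sum_congr rfl fun n _ => sum_congr rfl fun n' _ => by ring
          _ = ∑ n ∈ t, ∑ m ∈ s, ∑ n' ∈ t, β n * β n' * (L m n * L m n') := sum_comm
          _ = ∑ n ∈ t, ∑ n' ∈ t, ∑ m ∈ s, β n * β n' * (L m n * L m n') :=
              sum_congr rfl fun n _ => sum_comm
          _ = ∑ n ∈ t, ∑ n' ∈ t, β n * β n' * ∑ m ∈ s, L m n * L m n' :=
              sum_congr rfl fun n _ => sum_congr rfl fun n' _ => by rw [mul_sum]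

/-- Diagonal / off-diagonal split of the correlation form: if `|D(n,n)| ≤ X` on `t` and
`|D(n,n')| ≤ Y` for `n ≠ n'` in `t`, then
`∑_{n,n' ∈ t} β_n β_{n'} D(n,n') ≤ X ∑_t β² + Y · #t · ∑_t β²` (using `(∑|β|)² ≤ #t ∑ β²`). -/
theorem correlation_form_le (t : Finset ℕ) (β : ℕ → ℝ) (D : ℕ → ℕ → ℝ) {X Y : ℝ}
    (hY : 0 ≤ Y) (hdiag : ∀ n ∈ t, |D n n| ≤ X)
    (hoff : ∀ n ∈ t, ∀ n' ∈ t, n ≠ n' → |D n n'| ≤ Y) :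
    ∑ n ∈ t, ∑ n' ∈ t, β n * β n' * D n n' ≤
      X * ∑ n ∈ t, β n ^ 2 + Y * (#t * ∑ n ∈ t, β n ^ 2) := by
  have key : ∀ n ∈ t, ∀ n' ∈ t, β n * β n' * D n n' ≤
      (if n = n' then X * β n ^ 2 else 0) + Y * (|β n| * |β n'|) := by
    intro n hn n' hn'
    have h1 : β n * β n' * D n n' ≤ |β n| * |β n'| * |D n n'| := by
      rw [← abs_mul, ← abs_mul]; exact le_abs_self _
    have h0 : 0 ≤ |β n| * |β n'| := by positivity
    split_ifs with h
    · subst h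
      have h2 : |β n| * |β n| * |D n n| ≤ |β n| * |β n| * X :=
        mul_le_mul_of_nonneg_left (hdiag n hn) h0
      have h3 : 0 ≤ Y * (|β n| * |β n|) := mul_nonneg hY h0
      have h4 : |β n| * |β n| = β n ^ 2 := by rw [← sq, sq_abs]
      rw [h4] at h1 h2 h3 ⊢
      linarith
    · have h2 : |β n| * |β n'| * |D n n'| ≤ |β n| * |β n'| * Y :=
        mul_le_mul_of_nonneg_left (hoff n hn n' hn' h) h0
      nlinarith
  calc ∑ n ∈ t, ∑ n' ∈ t, β n * β n' * D n n'
      ≤ ∑ n ∈ t, ∑ n' ∈ t, ((if n = n' then X * β n ^ 2 else 0) + Y * (|β n| * |β n'|)) :=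
        sum_le_sum fun n hn => sum_le_sum fun n' hn' => key n hn n' hn'
    _ = X * ∑ n ∈ t, β n ^ 2 + Y * (∑ n ∈ t, |β n|) ^ 2 := by
        simp only [sum_add_distrib]
        congr 1
        · rw [mul_sum]
          exact sum_congr rfl fun n hn => by rw [sum_ite_eq, if_pos hn]
        · rw [sq, sum_mul_sum, mul_sum]
          exact sum_congr rfl fun n _ => by rw [mul_sum]
    _ ≤ X * ∑ n ∈ t, β n ^ 2 + Y * (#t * ∑ n ∈ t, β n ^ 2) := by
        gcongr
        calc (∑ n ∈ t, |β n|) ^ 2 ≤ #t * ∑ n ∈ t, |β n| ^ 2 := sq_sum_le_card_mul_sum_sq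
          _ = #t * ∑ n ∈ t, β n ^ 2 := by simp only [sq_abs]

/-- `S² ≤ A · B · Z` with `A, B ≥ 0` gives `|S| ≤ √A · √B · √Z`. -/
private theorem abs_le_sqrt_mul_sqrt_mul_sqrt {S A B Z : ℝ} (hA : 0 ≤ A) (hB : 0 ≤ B)
    (h : S ^ 2 ≤ A * B * Z) : |S| ≤ √A * √B * √Z := by
  rw [← Real.sqrt_mul hA, ← Real.sqrt_mul (mul_nonneg hA hB)]
  exact Real.abs_le_sqrt h

/-- **Type II from dilated two-point correlations** (the analytic core, abstract kernel). Let
`L : ℕ → ℕ → ℝ` with `|L(m,n)| ≤ 1`, and suppose the dilated correlation bound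
`|∑_{m ∈ (M,2M]} L(m,n) L(m,n')| ≤ C · M^{1-κ}` for all `1 ≤ n ≠ n' ≤ 2M`. Then for `1 ≤ N ≤ M` and
all real coefficients,
`|∑_{m ∈ (M,2M]} ∑_{n ∈ (N,2N]} α_m β_n L(m,n)| ≤ max 1 √(max C 0) · ‖α‖₂ ‖β‖₂ √(MN) (N^{-1/2} + M^{-κ/2})`.
Cauchy–Schwarz in `m`, diagonal `≤ M‖β‖²`, off-diagonal `≤ (max C 0) M^{1-κ} N ‖β‖²`,
`√(a+b) ≤ √a + √b`. -/
theorem abs_bilinear_le_of_correlations (L : ℕ → ℕ → ℝ) (hL1 : ∀ m n, |L m n| ≤ 1)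
    {κ C : ℝ} (M N : ℕ) (hN : 1 ≤ N) (hNM : N ≤ M)
    (hcorr : ∀ n n' : ℕ, 1 ≤ n → 1 ≤ n' → n ≠ n' → n ≤ 2 * M → n' ≤ 2 * M →
      |∑ m ∈ Ioc M (2 * M), L m n * L m n'| ≤ C * (M : ℝ) ^ (1 - κ))
    (α β : ℕ → ℝ) :
    |∑ m ∈ Ioc M (2 * M), ∑ n ∈ Ioc N (2 * N), α m * β n * L m n| ≤
      max 1 (√(max C 0)) * √(∑ m ∈ Ioc M (2 * M), α m ^ 2) * √(∑ n ∈ Ioc N (2 * N), β n ^ 2) *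
        √((M : ℝ) * N) * ((N : ℝ) ^ (-(1 / 2 : ℝ)) + (M : ℝ) ^ (-(κ / 2))) := by
  have hN0 : (0 : ℝ) < N := by exact_mod_cast hN
  have hM0 : (0 : ℝ) < M := by exact_mod_cast (hN.trans hNM)
  have hC₀ : 0 ≤ max C 0 := le_max_right _ _
  have hA0 : 0 ≤ ∑ m ∈ Ioc M (2 * M), α m ^ 2 := sum_nonneg fun _ _ => sq_nonneg _
  have hB0 : 0 ≤ ∑ n ∈ Ioc N (2 * N), β n ^ 2 := sum_nonneg fun _ _ => sq_nonneg _
  have hcard : (#(Ioc N (2 * N)) : ℝ) = N := by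
    rw [Nat.card_Ioc]; norm_cast; omega
  -- diagonal: `|L| ≤ 1` and `M` terms
  have hdiag : ∀ n ∈ Ioc N (2 * N), |∑ m ∈ Ioc M (2 * M), L m n * L m n| ≤ (M : ℝ) := by
    intro n _
    calc |∑ m ∈ Ioc M (2 * M), L m n * L m n|
        ≤ ∑ m ∈ Ioc M (2 * M), |L m n * L m n| := abs_sum_le_sum_abs _ _
      _ ≤ ∑ m ∈ Ioc M (2 * M), (1 : ℝ) := sum_le_sum fun m _ => by
          rw [abs_mul]; exact mul_le_one₀ (hL1 m n) (abs_nonneg _) (hL1 m n)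
      _ = M := by
          rw [sum_const, Nat.card_Ioc, nsmul_eq_mul, mul_one]; norm_cast; omega
  -- off-diagonal: `n, n' ∈ (N, 2N]`, so `1 ≤ n ≠ n' ≤ 2N ≤ 2M` is inside the correlation range
  have hoff : ∀ n ∈ Ioc N (2 * N), ∀ n' ∈ Ioc N (2 * N), n ≠ n' →
      |∑ m ∈ Ioc M (2 * M), L m n * L m n'| ≤ max C 0 * (M : ℝ) ^ (1 - κ) := by
    intro n hn n' hn' hne
    rw [mem_Ioc] at hn hn'
    calc |∑ m ∈ Ioc M (2 * M), L m n * L m n'| ≤ C * (M : ℝ) ^ (1 - κ) :=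
          hcorr n n' (by omega) (by omega) hne (by omega) (by omega)
      _ ≤ max C 0 * (M : ℝ) ^ (1 - κ) :=
          mul_le_mul_of_nonneg_right (le_max_left _ _) (by positivity)
  -- Cauchy–Schwarz and the split
  have hsq : (∑ m ∈ Ioc M (2 * M), ∑ n ∈ Ioc N (2 * N), α m * β n * L m n) ^ 2 ≤
      (∑ m ∈ Ioc M (2 * M), α m ^ 2) * (∑ n ∈ Ioc N (2 * N), β n ^ 2) *
        ((M : ℝ) + max C 0 * (M : ℝ) ^ (1 - κ) * N) := by
    have h2 : ∑ n ∈ Ioc N (2 * N), ∑ n' ∈ Ioc N (2 * N),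
        β n * β n' * ∑ m ∈ Ioc M (2 * M), L m n * L m n' ≤
        (M : ℝ) * ∑ n ∈ Ioc N (2 * N), β n ^ 2 +
          max C 0 * (M : ℝ) ^ (1 - κ) * (#(Ioc N (2 * N)) * ∑ n ∈ Ioc N (2 * N), β n ^ 2) :=
      correlation_form_le (Ioc N (2 * N)) β (fun n n' => ∑ m ∈ Ioc M (2 * M), L m n * L m n')
        (by positivity) hdiag hoff
    rw [hcard] at h2
    calc _ ≤ _ := bilinear_sq_le_mul_correlation_form (Ioc M (2 * M)) (Ioc N (2 * N)) α β L
      _ ≤ (∑ m ∈ Ioc M (2 * M), α m ^ 2) * ((M : ℝ) * ∑ n ∈ Ioc N (2 * N), β n ^ 2 +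
          max C 0 * (M : ℝ) ^ (1 - κ) * (N * ∑ n ∈ Ioc N (2 * N), β n ^ 2)) :=
          mul_le_mul_of_nonneg_left h2 hA0
      _ = _ := by ring
  have habs := abs_le_sqrt_mul_sqrt_mul_sqrt hA0 hB0 hsq
  -- `P = M^{(1-κ)/2}`, `M^{1-κ} = P²`
  obtain ⟨P, hP⟩ : ∃ P : ℝ, P = (M : ℝ) ^ ((1 - κ) / 2) := ⟨_, rfl⟩
  have hP0 : 0 ≤ P := by rw [hP]; positivity
  have hPsq : (M : ℝ) ^ (1 - κ) = P ^ 2 := by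
    rw [hP, ← Real.rpow_natCast, ← Real.rpow_mul hM0.le]
    congr 1; push_cast; ring
  have hsplit : √((M : ℝ) + max C 0 * (M : ℝ) ^ (1 - κ) * N) ≤ √(M : ℝ) + √(max C 0) * √(N : ℝ) * P := by
    calc √((M : ℝ) + max C 0 * (M : ℝ) ^ (1 - κ) * N)
        ≤ √(M : ℝ) + √(max C 0 * (M : ℝ) ^ (1 - κ) * N) :=
          sqrt_add_le_sqrt_add_sqrt (by positivity) (by positivity)
      _ = √(M : ℝ) + √(max C 0) * √(N : ℝ) * P := by
          rw [hPsq, Real.sqrt_mul' _ hN0.le, Real.sqrt_mul hC₀, Real.sqrt_sq hP0]; ring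
  -- the normalisation `√(MN) (N^{-1/2} + M^{-κ/2}) = √M + √N · M^{(1-κ)/2}`
  have hkey : √((M : ℝ) * N) * ((N : ℝ) ^ (-(1 / 2 : ℝ)) + (M : ℝ) ^ (-(κ / 2))) =
      √(M : ℝ) + √(N : ℝ) * P := by
    rw [Real.sqrt_mul hM0.le, Real.sqrt_eq_rpow (M : ℝ), Real.sqrt_eq_rpow (N : ℝ), hP, mul_add]
    congr 1
    · rw [mul_assoc, ← Real.rpow_add hN0]; norm_num
    · rw [mul_comm ((M : ℝ) ^ (1 / 2 : ℝ)), mul_assoc, ← Real.rpow_add hM0,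
        show (1 : ℝ) / 2 + -(κ / 2) = (1 - κ) / 2 by ring]
  have hK1 : (1 : ℝ) ≤ max 1 (√(max C 0)) := le_max_left _ _
  have hK2 : √(max C 0) ≤ max 1 (√(max C 0)) := le_max_right _ _
  calc |∑ m ∈ Ioc M (2 * M), ∑ n ∈ Ioc N (2 * N), α m * β n * L m n|
      ≤ √(∑ m ∈ Ioc M (2 * M), α m ^ 2) * √(∑ n ∈ Ioc N (2 * N), β n ^ 2) *
          √((M : ℝ) + max C 0 * (M : ℝ) ^ (1 - κ) * N) := habs
    _ ≤ √(∑ m ∈ Ioc M (2 * M), α m ^ 2) * √(∑ n ∈ Ioc N (2 * N), β n ^ 2) *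
          (√(M : ℝ) + √(max C 0) * √(N : ℝ) * P) :=
        mul_le_mul_of_nonneg_left hsplit (by positivity)
    _ ≤ √(∑ m ∈ Ioc M (2 * M), α m ^ 2) * √(∑ n ∈ Ioc N (2 * N), β n ^ 2) *
          (max 1 (√(max C 0)) * (√(M : ℝ) + √(N : ℝ) * P)) := by
        apply mul_le_mul_of_nonneg_left _ (by positivity)
        have h1 : √(M : ℝ) ≤ max 1 (√(max C 0)) * √(M : ℝ) :=
          le_mul_of_one_le_left (Real.sqrt_nonneg _) hK1
        have h2 : √(max C 0) * √(N : ℝ) * P ≤ max 1 (√(max C 0)) * (√(N : ℝ) * P) := by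
          rw [mul_assoc]; exact mul_le_mul_of_nonneg_right hK2 (by positivity)
        linarith [mul_add (max 1 (√(max C 0))) (√(M : ℝ)) (√(N : ℝ) * P)]
    _ = max 1 (√(max C 0)) * √(∑ m ∈ Ioc M (2 * M), α m ^ 2) *
          √(∑ n ∈ Ioc N (2 * N), β n ^ 2) *
          (√((M : ℝ) * N) * ((N : ℝ) ^ (-(1 / 2 : ℝ)) + (M : ℝ) ^ (-(κ / 2)))) := by
        rw [hkey]; ring
    _ = _ := by ring

/-- **`DilatedChowlaToTypeII`** (item stmt-Parity-13323 of route `LiouvilleMAD`):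
`DilatedChowla → TypeIILiouville`. Given the dilated two-point Chowla bound with exponent `κ` and
constant `C` at the shift `c ≠ 0`, the Type II bound for `λ(mn+c)` holds with `η = κ/2` and
constant `max 1 √(max C 0)`, by Cauchy–Schwarz over the long variable `m`
(`abs_bilinear_le_of_correlations` with `L(m,n) = λ((mn+c)⁺)`, `|λ| ≤ 1`). -/
theorem dilatedChowlaToTypeII_proof : DilatedChowlaToTypeII := by
  unfold DilatedChowlaToTypeII DilatedChowla TypeIILiouville
  intro hDC c hc
  obtain ⟨κ, hκ, C, hC⟩ := hDC c hc
  refine ⟨κ / 2, by positivity, max 1 (√(max C 0)), fun M N hN hNM α β => ?_⟩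
  exact abs_bilinear_le_of_correlations
    (fun m n => (ArithmeticFunction.liouville (Int.toNat ((m : ℤ) * n + c)) : ℝ))
    (fun m n => Literature.NumberTheory.Sieve.abs_liouville_le_one _) M N hN hNM
    (fun n n' h1 h1' hne hn hn' => hC M n n' h1 h1' hne hn hn') α β

end Summit.Parity.GeneralizedHardyLittlewood.Theorems
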